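import Literature.NumberTheory.GaloisCohomology.Howard2004.FiniteSingularNatural
import Literature.NumberTheory.GaloisCohomology.Howard2004.LevelQuotientProofs
import Literature.NumberTheory.GaloisRepresentations.GaloisCohomologyScalarActionLocalConditions
import HarnessLib

/-!
# Howard 2004, Def. 1.2.3: the scalars on Kolyvagin classes and on the finite–singular slot

Topic `NumberTheory/GaloisCohomology/Howard2004` (sequel to `SelmerTriples` §G and lit's
`FiniteSingularNatural`; cell `pub/bsd-print-x9`, x9-p1 LEAD ruling 2026-08-28 «(n2)»).  Definitions
with bodies and fully proved theorems; no named fact, no instance, no `sorry`.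

THE POINT.  `FiniteSingularNatural` pins the finite–singular slot `fs` of `LevelData` by
(i) bijectivity on the finite classes and (ii) naturality in the module, and records (reading note
(v)) why this is print-exact: two admissible slots differ by UNITS `u_ℓ`, and a unit rescaling of the
slot transports Kolyvagin systems, `κ ↦ κ″`, `κ″_n = (∏_{ℓ ∣ n} u_ℓ^{∓1}) κ_n`, with `κ″_1 = κ_1` —
while the conclusion of Thm. 1.6.1 only mentions `κ_1`.  This file and its sequel
`KolyvaginSystemRescalingProofs` are the KERNEL VERSION OF THE TRANSPORT (the second of the two
lemmas owed; the commutant lemma behind the first is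
`Literature.LinearAlgebra.UnimodularCommutantScalar`); this one sets up the scalars.  Everything is
over the landed `LevelData` / `LevelData.KS` (one level) and in lit's currencies `localH1Map` /
`singularQuotientMap`:

* §1 bridges (proved, mostly `rfl`): the tree's `ContinuousRep.cohomologyMap` of an `R`-linear
  equivariant map commutes with V2's scalars `scalarMapH1` (`cohomologyMap_scalarMapH1`);
  localisation vs `localH1Map` (`localization_cohomologyMap`); `localH1Map` of `r • id` IS
  `scalarMapH1` of the local module (`localH1Map_smul_id`); multiplicativity of
  `singularQuotientMap (r • id)`.
* §2 scalars: the presentations `T/I_nT` are `R`-linear (bsd-idea-16's `LevelData.isScalarLinear`); the level Selmer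
  groups `H¹_{F(n)}(K, T/I_nT)` are `R`-submodules (`IsSelmerScalarStable`, discharged from the
  place-wise stability of `F` and of Howard's transverse conditions by
  `isSelmerScalarStable_of_cond`); the scalar `r` on `H¹_{F(n)}` (`selmerAtSMul`), the rescaling of a
  family of classes `κ ↦ (c(n) · κ_n)_n` (`smulClasses`, multiplicative, `c ≡ 1 ⇒ id`), and
  `(r•) ⊗ 1` on `H¹_s(K_λ, T/I_nT) ⊗ G_ℓ` (`sqSMul`); «`fs` is natural along the SCALARS on the
  finite classes» (`FsScalarNaturalAt`, implied by lit's `FsNaturalAt`); «where `φ^{fs}` is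
  evaluated»: `loc_λ (red κ_n)` is a finite class (`localization_redH1_mem_unramifiedSubgroup`).
* `IsRescaledFs D hρ fs₂ u` — «`fs₂ = u_ℓ · fs` on the finite classes at every `(nℓ, ℓ)`», the
  relation between two slots under which the sequel `KolyvaginSystemRescalingProofs` transports
  Kolyvagin systems (`κ ∈ KS(fs₂) ⇒ ((∏_{ℓ∣n} w_ℓ) κ_n)_n ∈ KS(fs)`, `w_ℓ u_ℓ = 1`, `κ″_1 = κ_1`).

Hypotheses kept explicit (no hidden strengthening): `R`-linearity of `T` (`IsScalarLinear`), the
`R`-submodule property of the level Selmer groups (Howard Def. 1.1.1/1.1.10 — a predicate here, with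
its structural discharge), scalar-naturality of the slot on the finite classes (part of the pin).
The scalars `u, w` are elements of `R` indexed by the prime only (a compatible family of units of
the `R/I_n`, `n ∋ ℓ`, is the reduction of any lift of its `n = {ℓ}` member, and `I_n` acts by `0`).
Not here: the units themselves from (i)+(ii) for two slots (needs the evaluation isomorphism
`H¹_ur(K_λ, T/I_nT) ≅ T/I_nT`, (n1)'s territory; the algebra is `UnimodularCommutantScalar`), and
the levelwise `DVRSetting.KolyvaginSystem` repackaging.  BSD is not proved by any of this.

References: B. Howard, *The Heegner point Kolyvagin system*, Compositio Math. 140 (2004), Def. 1.1.1,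
1.1.3, 1.1.8, 1.1.10, 1.2.2–1.2.3 with display (ks relations), Thm. 1.7.5 (arXiv:1202.6340 pp. 5–7,
14); J.-P. Serre, *Galois Cohomology* (1997), I §2.
-/

set_option autoImplicit false

noncomputable section

open Function NumberField IsDedekindDomain Field
open scoped NumberField ContRepresentation Classical TensorProduct

namespace Literature.NumberTheory.GaloisCohomology.Howard2004

open Literature.NumberTheory.GaloisRepresentations
open Literature.NumberTheory.GaloisRepresentations.DiscreteGaloisModule
open Literature.NumberTheory.GaloisRepresentations.galoisCohomology

/-! ## 1. Bridges: the tree's `cohomologyMap`, localisation and the scalar action -/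

section Bridges

variable {K : Type} [Field K] [NumberField K]
  {N : Type} [AddCommGroup N] [TopologicalSpace N] [DiscreteTopology N]
  {N' : Type} [AddCommGroup N'] [TopologicalSpace N'] [DiscreteTopology N']
  {R : Type} [CommRing R] [Module R N] [Module R N']
  {ρ : DiscreteGaloisModule K N} {ρ' : DiscreteGaloisModule K N'}

omit [NumberField K] in
/-- `H¹(g)` of an `R`-linear equivariant map commutes with the scalar actions `H¹(r•)`
(the tree's `ContinuousRep.cohomologyMap` form of V2's `map_scalarMapH1`).
[cite: Howard2004HeegnerKolyvagin, §1 conventions `Mod_{R,K}` (arXiv p. 5, L3–24)] -/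
theorem cohomologyMap_scalarMapH1 (hρ : ρ.IsScalarLinear R) (hρ' : ρ'.IsScalarLinear R)
    (g : N →ₗ[R] N') (hg : ∀ (σ : absoluteGaloisGroup K) (x : N), g (ρ σ x) = ρ' σ (g x)) (r : R)
    (x : galoisCohomology ρ 1) :
    ContinuousRep.cohomologyMap ρ ρ' g.toAddMonoidHom continuous_of_discreteTopology hg 1
        (scalarMapH1 ρ hρ r x) =
      scalarMapH1 ρ' hρ' r
        (ContinuousRep.cohomologyMap ρ ρ' g.toAddMonoidHom continuous_of_discreteTopology hg 1 x) :=
  map_scalarMapH1 hρ hρ'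
    ⟨⟨g.toAddMonoidHom.toIntLinearMap, continuous_of_discreteTopology⟩,
      fun σ => ContinuousLinearMap.ext fun x => hg σ x⟩
    (fun r m => g.map_smul r m) r x

/-- Localisation at a finite place commutes with `H¹(g)`: `loc_v ∘ H¹(K, g) = H¹(K_v, g) ∘ loc_v`, in
the currencies `ContinuousRep.cohomologyMap` (global) / `localH1Map` (local).
[cite: Howard2004HeegnerKolyvagin, Def. 1.1.1 and Def. 1.1.3 (arXiv p. 5)] -/
theorem localization_cohomologyMap (g : N →+ N')
    (hg : ∀ (σ : absoluteGaloisGroup K) (x : N), g (ρ σ x) = ρ' σ (g x))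
    (v : HeightOneSpectrum (𝓞 K)) (x : galoisCohomology ρ 1) :
    galoisCohomology.localization ρ' (Sum.inr v) 1
        (ContinuousRep.cohomologyMap ρ ρ' g continuous_of_discreteTopology hg 1 x) =
      localH1Map ρ ρ' v g (fun _ y => hg _ y) (galoisCohomology.localization ρ (Sum.inr v) 1 x) :=
  Literature.NumberTheory.EllipticCurves.DiscreteGaloisModule.localization_map_one
    ⟨⟨g.toIntLinearMap, continuous_of_discreteTopology⟩,
      fun σ => ContinuousLinearMap.ext fun y => hg σ y⟩ (Sum.inr v) x

/-- The local equivariance of the scalar endomorphism `r • id` of an `R`-linear module.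
[cite: Howard2004HeegnerKolyvagin, §1 conventions `Mod_{R,K}` (arXiv p. 5, L3–24)] -/
theorem smul_id_toLocal (hρ : ρ.IsScalarLinear R) (v : HeightOneSpectrum (𝓞 K)) (r : R)
    (σ : absoluteGaloisGroup (v.adicCompletion K)) (x : N) :
    (r • LinearMap.id : N →ₗ[R] N).toAddMonoidHom (GaloisRep.toLocal v ρ σ x) =
      GaloisRep.toLocal v ρ σ ((r • LinearMap.id : N →ₗ[R] N).toAddMonoidHom x) := by
  simp [GaloisRep.toLocal_apply, hρ _ r x]

/-- The same, unbundled: `r • (σ · x) = σ · (r • x)` for `σ ∈ Γ_{K_v}`.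
[cite: Howard2004HeegnerKolyvagin, §1 conventions `Mod_{R,K}` (arXiv p. 5, L3–24)] -/
theorem smul_toLocal_comm (hρ : ρ.IsScalarLinear R) (v : HeightOneSpectrum (𝓞 K)) (r : R)
    (σ : absoluteGaloisGroup (v.adicCompletion K)) (x : N) :
    r • GaloisRep.toLocal v ρ σ x = GaloisRep.toLocal v ρ σ (r • x) := by
  rw [GaloisRep.toLocal_apply]
  exact (hρ _ r x).symm

/-- `H¹(K_v, r • id) = H¹(r•)` on the local cohomology: lit's `localH1Map` of the scalar endomorphism
IS V2's `scalarMapH1` of the local module. [cite: Howard2004HeegnerKolyvagin, Def. 1.1.1 (arXiv p. 5, L20–24)] -/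
theorem localH1Map_smul_id (hρ : ρ.IsScalarLinear R) (v : HeightOneSpectrum (𝓞 K)) (r : R) :
    localH1Map ρ ρ v (r • LinearMap.id : N →ₗ[R] N).toAddMonoidHom (smul_id_toLocal hρ v r) =
      scalarMapH1 (GaloisRep.toLocal v ρ) (hρ.restrictField (v.adicCompletion K)) r :=
  rfl

/-- Localisation commutes with the scalars, read in lit's `localH1Map` currency.
[cite: Howard2004HeegnerKolyvagin, Def. 1.1.1 (arXiv p. 5, L20–24)] -/
theorem localization_scalarMapH1' (hρ : ρ.IsScalarLinear R) (v : HeightOneSpectrum (𝓞 K)) (r : R)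
    (x : galoisCohomology ρ 1) :
    galoisCohomology.localization ρ (Sum.inr v) 1 (scalarMapH1 ρ hρ r x) =
      localH1Map ρ ρ v (r • LinearMap.id : N →ₗ[R] N).toAddMonoidHom (smul_id_toLocal hρ v r)
        (galoisCohomology.localization ρ (Sum.inr v) 1 x) := by
  rw [localH1Map_smul_id hρ]
  exact localization_scalarMapH1 hρ (Sum.inr v) r x

/-- The same read through any additive map out of `H¹(K_v, N)` in lit's `GaloisRep.toLocal` currency
(e.g. the singular projection `loc^s`): states the commutation once in that currency, so that users
need not re-identify `H¹((N, ρ).toLocal v)` with `H¹(K_v, N|_{Γ_{K_v}})`.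
[cite: Howard2004HeegnerKolyvagin, Def. 1.1.1 (arXiv p. 5, L20–24)] -/
theorem apply_localization_scalarMapH1 (hρ : ρ.IsScalarLinear R) (v : HeightOneSpectrum (𝓞 K))
    {P : Type} [AddCommGroup P] (f : galoisCohomology (GaloisRep.toLocal v ρ) 1 →+ P) (r : R)
    (x : galoisCohomology ρ 1) :
    f (galoisCohomology.localization ρ (Sum.inr v) 1 (scalarMapH1 ρ hρ r x)) =
      f (localH1Map ρ ρ v (r • LinearMap.id : N →ₗ[R] N).toAddMonoidHom (smul_id_toLocal hρ v r)
        (galoisCohomology.localization ρ (Sum.inr v) 1 x)) :=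
  congrArg f (localization_scalarMapH1' hρ v r x)

/-- `H¹_s(K_v, (r s) • id) = H¹_s(K_v, r • id) ∘ H¹_s(K_v, s • id)` on the singular quotient.
[cite: Howard2004HeegnerKolyvagin, Def. 1.1.1 singular quotient (arXiv p. 5, L58–70)] -/
theorem singularQuotientMap_smul_id_mul (hρ : ρ.IsScalarLinear R) (v : HeightOneSpectrum (𝓞 K))
    (r s : R) :
    singularQuotientMap ρ ρ v ((r * s) • LinearMap.id : N →ₗ[R] N).toAddMonoidHom
        (smul_id_toLocal hρ v (r * s)) =
      (singularQuotientMap ρ ρ v (r • LinearMap.id : N →ₗ[R] N).toAddMonoidHom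
          (smul_id_toLocal hρ v r)).comp
        (singularQuotientMap ρ ρ v (s • LinearMap.id : N →ₗ[R] N).toAddMonoidHom
          (smul_id_toLocal hρ v s)) := by
  refine AddMonoidHom.ext fun q => ?_
  obtain ⟨c, rfl⟩ := QuotientAddGroup.mk'_surjective (unramifiedSubgroup (GaloisRep.toLocal v ρ) 1) q
  change singularQuotientMap _ _ v _ _ (singularMap _ c) =
    singularQuotientMap _ _ v _ _ (singularQuotientMap _ _ v _ _ (singularMap _ c))
  rw [singularQuotientMap_singularMap, singularQuotientMap_singularMap,
    singularQuotientMap_singularMap, localH1Map_smul_id hρ, localH1Map_smul_id hρ,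
    localH1Map_smul_id hρ, scalarMapH1_mul]
  rfl

/-- `H¹_s(K_v, 1 • id) = id`. [cite: Howard2004HeegnerKolyvagin, Def. 1.1.1 singular quotient (arXiv p. 5, L58–70)] -/
theorem singularQuotientMap_one_smul_id (hρ : ρ.IsScalarLinear R) (v : HeightOneSpectrum (𝓞 K)) :
    singularQuotientMap ρ ρ v ((1 : R) • LinearMap.id : N →ₗ[R] N).toAddMonoidHom
        (smul_id_toLocal hρ v 1) = AddMonoidHom.id _ := by
  refine AddMonoidHom.ext fun q => ?_
  obtain ⟨c, rfl⟩ := QuotientAddGroup.mk'_surjective (unramifiedSubgroup (GaloisRep.toLocal v ρ) 1) q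
  change singularQuotientMap _ _ v _ _ (singularMap _ c) = singularMap _ c
  rw [singularQuotientMap_singularMap, localH1Map_smul_id hρ, scalarMapH1_one]
  rfl

end Bridges

/-! ## 2. The scalars on the presentations, the level Selmer groups and the Kolyvagin classes -/

namespace LevelData

variable {K : Type} [Field K] [NumberField K] {M : Type} [AddCommGroup M] [TopologicalSpace M]
  [DiscreteTopology M] {R : Type} [CommRing R] [Module R M]
  {p : ℕ} [Fact p.Prime] {ρ : DiscreteGaloisModule K M} {t : SelmerTriple p ρ}
  {N : Finset (HeightOneSpectrum (𝓞 K)) → Type} [∀ n, AddCommGroup (N n)]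
  [∀ n, TopologicalSpace (N n)] [∀ n, DiscreteTopology (N n)] [∀ n, Module R (N n)]


omit [Fact p.Prime] in
/-- `H¹` of the transition `T/I_nT → T/I_{nℓ}T` commutes with the scalars.
[cite: Howard2004HeegnerKolyvagin, Def. 1.1.3 and Def. 1.2.3 (arXiv p. 5 L95–97, p. 6 L126–140)] -/
theorem redH1_scalarMapH1 (D : LevelData R ρ t N) (hρ : ρ.IsScalarLinear R)
    (n : Finset (HeightOneSpectrum (𝓞 K))) (v : HeightOneSpectrum (𝓞 K)) (r : R)
    (x : galoisCohomology (D.ρq n) 1) :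
    D.redH1 n v (scalarMapH1 (D.ρq n) (D.isScalarLinear hρ n) r x) =
      scalarMapH1 (D.ρq (insert v n)) (D.isScalarLinear hρ (insert v n)) r (D.redH1 n v x) :=
  cohomologyMap_scalarMapH1 _ _
    ((D.isQuotientBy n).transition (D.isQuotientBy (insert v n))
      (levelIdeal_mono ρ (Finset.subset_insert v n)))
    ((D.isQuotientBy n).transition_equivariant (D.isQuotientBy (insert v n))
      (levelIdeal_mono ρ (Finset.subset_insert v n))) r x

omit [Fact p.Prime] in
/-- Localisation at `λ` of `H¹` of the transition `T/I_nT → T/I_{nℓ}T` is `H¹(K_λ, ·)` of the transition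
after localisation. [cite: Howard2004HeegnerKolyvagin, Def. 1.2.3, display (ks relations) (arXiv p. 6, L126–140)] -/
theorem localization_redH1 (D : LevelData R ρ t N) (n : Finset (HeightOneSpectrum (𝓞 K)))
    (v w : HeightOneSpectrum (𝓞 K)) (x : galoisCohomology (D.ρq n) 1) :
    galoisCohomology.localization (D.ρq (insert v n)) (Sum.inr w) 1 (D.redH1 n v x) =
      localH1Map (D.ρq n) (D.ρq (insert v n)) w
        ((D.isQuotientBy n).transition (D.isQuotientBy (insert v n))
          (levelIdeal_mono ρ (Finset.subset_insert v n))).toAddMonoidHom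
        (fun _ y => (D.isQuotientBy n).transition_equivariant (D.isQuotientBy (insert v n))
          (levelIdeal_mono ρ (Finset.subset_insert v n)) _ y)
        (galoisCohomology.localization (D.ρq n) (Sum.inr w) 1 x) :=
  localization_cohomologyMap _ _ w x

omit [Fact p.Prime] in
/-- The local map `H¹(K_v, T) → H¹(K_v, T/IT)` of a presentation is lit's `localH1Map` of the
presenting surjection. [cite: Howard2004HeegnerKolyvagin, Def. 1.1.3 (arXiv p. 5, L93–99)] -/
theorem _root_.Literature.NumberTheory.GaloisCohomology.Howard2004.IsQuotientBy.localCohomologyMap_inr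
    {N₁ : Type} [AddCommGroup N₁] [TopologicalSpace N₁] [DiscreteTopology N₁] [Module R N₁]
    {I : Ideal R} {ρI : DiscreteGaloisModule K N₁} {π : M →ₗ[R] N₁} (h : IsQuotientBy ρ I ρI π)
    (v : HeightOneSpectrum (𝓞 K)) :
    h.localCohomologyMap (Sum.inr v) 1 =
      localH1Map ρ ρI v π.toAddMonoidHom (fun _ m => h.equivariant _ m) :=
  rfl

/-- **Where `φ^{fs}` is evaluated**: for a Selmer class `x ∈ H¹_{F(n)}(K, T/I_nT)` and a prime
`λ ∈ 𝓛` not dividing `n`, the localisation of `x` at `λ` is an UNRAMIFIED (= finite) class — the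
condition of `F(n)` at `λ ∉ n` is the one propagated from `F`, whose condition at a prime of `𝓛` is the
finite one (`𝓛 ∩ Σ(F) = ∅`). [cite: Howard2004HeegnerKolyvagin, Def. 1.2.2–1.2.3 (arXiv p. 6, L101–140)] -/
theorem localization_mem_unramifiedSubgroup_of_mem_selmerAt (D : LevelData R ρ t N)
    (jbar : AlgebraicClosure K →+* ℂ) {n : Finset (HeightOneSpectrum (𝓞 K))}
    {v : HeightOneSpectrum (𝓞 K)} (hv : v ∉ n) (hvP : v ∈ t.primes)
    {x : galoisCohomology (D.ρq n) 1} (hx : x ∈ D.selmerAt jbar n) :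
    galoisCohomology.localization (D.ρq n) (Sum.inr v) 1 x ∈
      unramifiedSubgroup (GaloisRep.toLocal v (D.ρq n)) 1 := by
  have h1 := (SelmerStructure.mem_selmerGroup_iff _ x).mp hx (Sum.inr v)
  rw [IsQuotientBy.propagateStructure_apply, t.atLevel_cond_inr_of_not_mem jbar hv,
    t.cond_inr_eq_of_mem hvP, AddSubgroup.mem_map] at h1
  obtain ⟨b, hb, hbx⟩ := h1
  rw [← hbx, IsQuotientBy.localCohomologyMap_inr]
  exact localH1Map_mem_unramifiedSubgroup _ _ v _ _ hb

/-- The same after the transition to level `nℓ`: `loc_λ (red κ_n) ∈ H¹_ur(K_λ, T/I_{nℓ}T)` — the class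
to which display (ks relations) applies `φ^{fs}_ℓ`.
[cite: Howard2004HeegnerKolyvagin, Def. 1.2.3, display (ks relations) (arXiv p. 6, L126–140)] -/
theorem localization_redH1_mem_unramifiedSubgroup (D : LevelData R ρ t N)
    (jbar : AlgebraicClosure K →+* ℂ) {n : Finset (HeightOneSpectrum (𝓞 K))}
    {v : HeightOneSpectrum (𝓞 K)} (hv : v ∉ n) (hvP : v ∈ t.primes)
    {x : galoisCohomology (D.ρq n) 1} (hx : x ∈ D.selmerAt jbar n) :
    galoisCohomology.localization (D.ρq (insert v n)) (Sum.inr v) 1 (D.redH1 n v x) ∈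
      unramifiedSubgroup (GaloisRep.toLocal v (D.ρq (insert v n))) 1 := by
  rw [localization_redH1]
  exact localH1Map_mem_unramifiedSubgroup _ _ v _ _
    (D.localization_mem_unramifiedSubgroup_of_mem_selmerAt jbar hv hvP hx)

omit [Fact p.Prime] in
/-- A level `nℓ ∈ 𝓝(𝓛)` has `ℓ ∈ 𝓛`. [cite: Howard2004HeegnerKolyvagin, Def. 1.2.1 (arXiv p. 6, L73–75)] -/
theorem mem_primes_of_insert_mem_levelSet {n : Finset (HeightOneSpectrum (𝓞 K))}
    {v : HeightOneSpectrum (𝓞 K)} (hn : insert v n ∈ t.levelSet) : v ∈ t.primes :=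
  hn (Finset.mem_coe.mpr (Finset.mem_insert_self v n))

/-- **The level Selmer groups are `R`-submodules** (hypothesis form): every
`H¹_{F(n)}(K, T/I_nT)` is stable under the scalars `H¹(r•)` — Howard's local conditions are
`R`-submodules (Def. 1.1.1), hence so are the Selmer modules (Def. 1.1.10).  Discharged from the
place-wise stability of the structures `F(n)` by `isSelmerScalarStable_of_isScalarStable` /
`isSelmerScalarStable_of_cond`.
[cite: Howard2004HeegnerKolyvagin, Def. 1.1.1 and Def. 1.1.10 (arXiv p. 5 L20–21, p. 6 L10–33)] -/
def IsSelmerScalarStable (D : LevelData R ρ t N) (jbar : AlgebraicClosure K →+* ℂ)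
    (hρ : ρ.IsScalarLinear R) : Prop :=
  ∀ (n : Finset (HeightOneSpectrum (𝓞 K))) (r : R), ∀ x ∈ D.selmerAt jbar n,
    scalarMapH1 (D.ρq n) (D.isScalarLinear hρ n) r x ∈ D.selmerAt jbar n

omit [Fact p.Prime] in
/-- Propagation to a quotient keeps place-wise scalar-stability: if `F` on `T` is stable, so is the
structure propagated to `T/IT` (`H¹(K_v, π)` commutes with the scalars).
[cite: Howard2004HeegnerKolyvagin, Def. 1.1.1 and Def. 1.1.3 (arXiv p. 5, L36–44 and L93–99)] -/
theorem _root_.Literature.NumberTheory.GaloisCohomology.Howard2004.IsQuotientBy.isScalarStable_propagateStructure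
    {N₁ : Type} [AddCommGroup N₁] [TopologicalSpace N₁] [DiscreteTopology N₁] [Module R N₁]
    {I : Ideal R} {ρI : DiscreteGaloisModule K N₁} {π : M →ₗ[R] N₁} (h : IsQuotientBy ρ I ρI π)
    (hρ : ρ.IsScalarLinear R) {F : SelmerStructure ρ} (hF : F.IsScalarStable hρ) :
    (h.propagateStructure F).IsScalarStable (h.isScalarLinear hρ) := by
  intro w r x hx
  rw [IsQuotientBy.propagateStructure_apply, AddSubgroup.mem_map] at hx ⊢
  obtain ⟨b, hb, rfl⟩ := hx
  refine ⟨scalarMapH1 (ρ.toLocal w) (hρ.restrictField (Place.Completion w)) r b, hF w r hb, ?_⟩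
  unfold IsQuotientBy.localCohomologyMap
  exact cohomologyMap_scalarMapH1 (ρ := ρ.toLocal w) (ρ' := ρI.toLocal w)
    (hρ.restrictField (Place.Completion w)) ((h.isScalarLinear hρ).restrictField (Place.Completion w))
    π (fun σ m => h.equivariant _ m) r b

/-- From place-wise stability of the level structures `F(n)` on the presentations.
[cite: Howard2004HeegnerKolyvagin, Def. 1.1.10 (arXiv p. 6, L10–33)] -/
theorem isSelmerScalarStable_of_isScalarStable (D : LevelData R ρ t N)
    (jbar : AlgebraicClosure K →+* ℂ) (hρ : ρ.IsScalarLinear R)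
    (h : ∀ n, ((D.isQuotientBy n).propagateStructure (t.atLevel jbar n).cond).IsScalarStable
      (D.isScalarLinear hρ n)) :
    D.IsSelmerScalarStable jbar hρ := by
  intro n r x hx
  unfold selmerAt at hx ⊢
  exact SelmerStructure.scalarMapH1_mem_selmerGroup (D.isScalarLinear hρ n) (h n) r hx

/-- **From the structure of the triple**: if the conditions of `F` and Howard's transverse conditions
are `R`-submodules, every level Selmer group `H¹_{F(n)}(K, T/I_nT)` is stable under the scalars
(`F(n) = F^∅_∅(n)` modifies `F` transversally at `n`, then propagates to `T/I_nT`).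
[cite: Howard2004HeegnerKolyvagin, Def. 1.2.2–1.2.3 (arXiv p. 6, L101–140)] -/
theorem isSelmerScalarStable_of_cond (D : LevelData R ρ t N) (jbar : AlgebraicClosure K →+* ℂ)
    (hρ : ρ.IsScalarLinear R) (hc : t.cond.IsScalarStable hρ)
    (htr : (transverseStructure p ρ jbar).IsScalarStable hρ) : D.IsSelmerScalarStable jbar hρ :=
  D.isSelmerScalarStable_of_isScalarStable jbar hρ fun n =>
    (D.isQuotientBy n).isScalarStable_propagateStructure hρ
      (SelmerStructure.IsScalarStable.modify hρ hc htr ∅ ∅ n)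

/-- **`r ∈ R` acting on `H¹_{F(n)}(K, T/I_nT)`** (the restriction of `H¹(r•)` to the stable level
Selmer group). [cite: Howard2004HeegnerKolyvagin, Def. 1.1.10 and Def. 1.2.3 (arXiv p. 6 L10–33, p. 7 L1–12)] -/
def selmerAtSMul (D : LevelData R ρ t N) (jbar : AlgebraicClosure K →+* ℂ) (hρ : ρ.IsScalarLinear R)
    (hst : D.IsSelmerScalarStable jbar hρ) (n : Finset (HeightOneSpectrum (𝓞 K))) (r : R) :
    ↥(D.selmerAt jbar n) →+ ↥(D.selmerAt jbar n) :=
  ((scalarMapH1 (D.ρq n) (D.isScalarLinear hρ n) r).restrict (D.selmerAt jbar n)).codRestrict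
    (D.selmerAt jbar n) fun x => hst n r x.1 x.2

/-- Unfolding `selmerAtSMul` in `H¹(K, T/I_nT)`. [cite: Howard2004HeegnerKolyvagin, Def. 1.1.10 (arXiv p. 6, L10–33)] -/
@[simp] theorem coe_selmerAtSMul (D : LevelData R ρ t N) (jbar : AlgebraicClosure K →+* ℂ)
    (hρ : ρ.IsScalarLinear R) (hst : D.IsSelmerScalarStable jbar hρ)
    (n : Finset (HeightOneSpectrum (𝓞 K))) (r : R) (x : ↥(D.selmerAt jbar n)) :
    ((D.selmerAtSMul jbar hρ hst n r x : ↥(D.selmerAt jbar n)) : galoisCohomology (D.ρq n) 1) =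
      scalarMapH1 (D.ρq n) (D.isScalarLinear hρ n) r x :=
  rfl

/-- `(r s)• = r• ∘ s•` on `H¹_{F(n)}`. [cite: Howard2004HeegnerKolyvagin, Def. 1.1.10 (arXiv p. 6, L10–33)] -/
theorem selmerAtSMul_mul (D : LevelData R ρ t N) (jbar : AlgebraicClosure K →+* ℂ)
    (hρ : ρ.IsScalarLinear R) (hst : D.IsSelmerScalarStable jbar hρ)
    (n : Finset (HeightOneSpectrum (𝓞 K))) (r s : R) :
    D.selmerAtSMul jbar hρ hst n (r * s) =
      (D.selmerAtSMul jbar hρ hst n r).comp (D.selmerAtSMul jbar hρ hst n s) := by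
  refine AddMonoidHom.ext fun x => Subtype.ext ?_
  simp [scalarMapH1_mul]

/-- `1• = id` on `H¹_{F(n)}`. [cite: Howard2004HeegnerKolyvagin, Def. 1.1.10 (arXiv p. 6, L10–33)] -/
theorem selmerAtSMul_one (D : LevelData R ρ t N) (jbar : AlgebraicClosure K →+* ℂ)
    (hρ : ρ.IsScalarLinear R) (hst : D.IsSelmerScalarStable jbar hρ)
    (n : Finset (HeightOneSpectrum (𝓞 K))) :
    D.selmerAtSMul jbar hρ hst n 1 = AddMonoidHom.id _ := by
  refine AddMonoidHom.ext fun x => Subtype.ext ?_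
  simp [scalarMapH1_one]

/-- **Rescaling a family of classes**: `κ ↦ (c(n) · κ_n)_n` for level-dependent scalars `c(n) ∈ R`
acting on the Selmer factor of `H¹_{F(n)}(K, T/I_nT) ⊗ G_n` (Howard's renormalisations, cf. the
`χ_n`-renormalisation of Thm. 1.7.5, are of this shape with `c(n) = ∏_{ℓ ∣ n} u_ℓ`).
[cite: Howard2004HeegnerKolyvagin, Def. 1.2.3 and Thm. 1.7.5 (arXiv p. 7 L1–12, p. 14 L30–44)] -/
def smulClasses (D : LevelData R ρ t N) (jbar : AlgebraicClosure K →+* ℂ) (hρ : ρ.IsScalarLinear R)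
    (hst : D.IsSelmerScalarStable jbar hρ) (c : Finset (HeightOneSpectrum (𝓞 K)) → R)
    (κ : ∀ n : Finset (HeightOneSpectrum (𝓞 K)), ↥(D.selmerAt jbar n) ⊗[ℤ] Gn (K := K) n)
    (n : Finset (HeightOneSpectrum (𝓞 K))) : ↥(D.selmerAt jbar n) ⊗[ℤ] Gn (K := K) n :=
  TensorProduct.map (D.selmerAtSMul jbar hρ hst n (c n)).toIntLinearMap LinearMap.id (κ n)

/-- Unfolding `smulClasses`. [cite: Howard2004HeegnerKolyvagin, Def. 1.2.3 (arXiv p. 7, L1–12)] -/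
theorem smulClasses_apply (D : LevelData R ρ t N) (jbar : AlgebraicClosure K →+* ℂ)
    (hρ : ρ.IsScalarLinear R) (hst : D.IsSelmerScalarStable jbar hρ)
    (c : Finset (HeightOneSpectrum (𝓞 K)) → R)
    (κ : ∀ n : Finset (HeightOneSpectrum (𝓞 K)), ↥(D.selmerAt jbar n) ⊗[ℤ] Gn (K := K) n)
    (n : Finset (HeightOneSpectrum (𝓞 K))) :
    D.smulClasses jbar hρ hst c κ n =
      TensorProduct.map (D.selmerAtSMul jbar hρ hst n (c n)).toIntLinearMap LinearMap.id (κ n) :=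
  rfl

/-- Rescaling is multiplicative in the scalars. [cite: Howard2004HeegnerKolyvagin, Def. 1.2.3 (arXiv p. 7, L1–12)] -/
theorem smulClasses_mul (D : LevelData R ρ t N) (jbar : AlgebraicClosure K →+* ℂ)
    (hρ : ρ.IsScalarLinear R) (hst : D.IsSelmerScalarStable jbar hρ)
    (c c' : Finset (HeightOneSpectrum (𝓞 K)) → R)
    (κ : ∀ n : Finset (HeightOneSpectrum (𝓞 K)), ↥(D.selmerAt jbar n) ⊗[ℤ] Gn (K := K) n) :
    D.smulClasses jbar hρ hst (fun n => c n * c' n) κ =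
      D.smulClasses jbar hρ hst c (D.smulClasses jbar hρ hst c' κ) := by
  funext n
  simp only [smulClasses_apply, selmerAtSMul_mul]
  rw [← LinearMap.comp_apply (TensorProduct.map _ _), ← TensorProduct.map_comp]
  rfl

/-- Rescaling by `1` is the identity; more generally `c(n) = 1 ⇒ (c · κ)_n = κ_n` (so `κ_1` is
unchanged under `c(n) = ∏_{ℓ ∣ n} u_ℓ`). [cite: Howard2004HeegnerKolyvagin, Def. 1.2.3 (arXiv p. 7, L1–12)] -/
theorem smulClasses_apply_of_eq_one (D : LevelData R ρ t N) (jbar : AlgebraicClosure K →+* ℂ)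
    (hρ : ρ.IsScalarLinear R) (hst : D.IsSelmerScalarStable jbar hρ)
    (c : Finset (HeightOneSpectrum (𝓞 K)) → R)
    (κ : ∀ n : Finset (HeightOneSpectrum (𝓞 K)), ↥(D.selmerAt jbar n) ⊗[ℤ] Gn (K := K) n)
    {n : Finset (HeightOneSpectrum (𝓞 K))} (hn : c n = 1) : D.smulClasses jbar hρ hst c κ n = κ n := by
  rw [smulClasses_apply, hn, selmerAtSMul_one]
  exact congrArg (fun f => f (κ n)) TensorProduct.map_id ▸ rfl

/-- Rescaling by `c` then by `c'` with `c' c = 1` pointwise is the identity (the rescalings by units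
are bijections). [cite: Howard2004HeegnerKolyvagin, Def. 1.2.3 (arXiv p. 7, L1–12)] -/
theorem smulClasses_smulClasses_of_mul_eq_one (D : LevelData R ρ t N)
    (jbar : AlgebraicClosure K →+* ℂ) (hρ : ρ.IsScalarLinear R) (hst : D.IsSelmerScalarStable jbar hρ)
    (c c' : Finset (HeightOneSpectrum (𝓞 K)) → R) (h : ∀ n, c n * c' n = 1)
    (κ : ∀ n : Finset (HeightOneSpectrum (𝓞 K)), ↥(D.selmerAt jbar n) ⊗[ℤ] Gn (K := K) n) :
    D.smulClasses jbar hρ hst c (D.smulClasses jbar hρ hst c' κ) = κ := by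
  rw [← smulClasses_mul]
  funext n
  exact D.smulClasses_apply_of_eq_one jbar hρ hst _ κ (h n)

omit [Fact p.Prime] in
/-- **`(r•) ⊗ 1` on `H¹_s(K_λ, T/I_nT) ⊗ G_ℓ`**: the scalar `r` on the singular quotient (lit's
`singularQuotientMap` of `r • id`) tensored with `G_ℓ` — the target-side form of «`u · φ^{fs}`».
[cite: Howard2004HeegnerKolyvagin, Def. 1.1.8 and Def. 1.2.3 (arXiv p. 5 L126–131, p. 6 L126–140)] -/
def sqSMul (D : LevelData R ρ t N) (hρ : ρ.IsScalarLinear R) (n : Finset (HeightOneSpectrum (𝓞 K)))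
    (v : HeightOneSpectrum (𝓞 K)) (r : R) :
    SingularQuotient (GaloisRep.toLocal v (D.ρq n)) ⊗[ℤ] Gell v →ₗ[ℤ]
      SingularQuotient (GaloisRep.toLocal v (D.ρq n)) ⊗[ℤ] Gell v :=
  TensorProduct.map
    (singularQuotientMap (D.ρq n) (D.ρq n) v (r • LinearMap.id : N n →ₗ[R] N n).toAddMonoidHom
      (smul_id_toLocal (D.isScalarLinear hρ n) v r)).toIntLinearMap
    LinearMap.id

omit [Fact p.Prime] in
/-- Unfolding `sqSMul`. [cite: Howard2004HeegnerKolyvagin, Def. 1.1.8 (arXiv p. 5, L126–131)] -/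
theorem sqSMul_def (D : LevelData R ρ t N) (hρ : ρ.IsScalarLinear R)
    (n : Finset (HeightOneSpectrum (𝓞 K))) (v : HeightOneSpectrum (𝓞 K)) (r : R) :
    D.sqSMul hρ n v r = TensorProduct.map
      (singularQuotientMap (D.ρq n) (D.ρq n) v (r • LinearMap.id : N n →ₗ[R] N n).toAddMonoidHom
        (smul_id_toLocal (D.isScalarLinear hρ n) v r)).toIntLinearMap LinearMap.id :=
  rfl

omit [Fact p.Prime] in
/-- `((r s)•) ⊗ 1 = ((r•) ⊗ 1) ∘ ((s•) ⊗ 1)`. [cite: Howard2004HeegnerKolyvagin, Def. 1.1.8 (arXiv p. 5, L126–131)] -/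
theorem sqSMul_mul (D : LevelData R ρ t N) (hρ : ρ.IsScalarLinear R)
    (n : Finset (HeightOneSpectrum (𝓞 K))) (v : HeightOneSpectrum (𝓞 K)) (r s : R) :
    D.sqSMul hρ n v (r * s) = D.sqSMul hρ n v r ∘ₗ D.sqSMul hρ n v s := by
  rw [sqSMul_def, singularQuotientMap_smul_id_mul (D.isScalarLinear hρ n), sqSMul_def, sqSMul_def,
    ← TensorProduct.map_comp]
  rfl

omit [Fact p.Prime] in
/-- `(1•) ⊗ 1 = id`. [cite: Howard2004HeegnerKolyvagin, Def. 1.1.8 (arXiv p. 5, L126–131)] -/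
theorem sqSMul_one (D : LevelData R ρ t N) (hρ : ρ.IsScalarLinear R)
    (n : Finset (HeightOneSpectrum (𝓞 K))) (v : HeightOneSpectrum (𝓞 K)) :
    D.sqSMul hρ n v 1 = LinearMap.id := by
  rw [sqSMul_def, singularQuotientMap_one_smul_id (D.isScalarLinear hρ n), ← TensorProduct.map_id]
  rfl

omit [Fact p.Prime] in
/-- `((r•) ⊗ 1) ∘ ((s•) ⊗ 1) = ((r s)•) ⊗ 1` on elements. [cite: Howard2004HeegnerKolyvagin, Def. 1.1.8 (arXiv p. 5, L126–131)] -/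
theorem map_sqSMul_map_sqSMul (D : LevelData R ρ t N) (hρ : ρ.IsScalarLinear R)
    (m : Finset (HeightOneSpectrum (𝓞 K))) (v : HeightOneSpectrum (𝓞 K)) (r s : R)
    {P : Type} {_ : AddCommMonoid P} {_ : Module ℤ P}
    (x : (SingularQuotient (GaloisRep.toLocal v (D.ρq m)) ⊗[ℤ] Gell v) ⊗[ℤ] P) :
    TensorProduct.map (D.sqSMul hρ m v r) LinearMap.id
        (TensorProduct.map (D.sqSMul hρ m v s) LinearMap.id x) =
      TensorProduct.map (D.sqSMul hρ m v (r * s)) (LinearMap.id : P →ₗ[ℤ] P) x := by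
  rw [sqSMul_mul]
  exact (LinearMap.rTensor_comp_apply _ _ _ x).symm

/-- **The slot is natural along the SCALAR endomorphisms** at `(T/I_mT, λ)`, on the finite classes:
`fs (H¹(r•) c) = ((r•) ⊗ 1) (fs c)` for `c ∈ H¹_ur(K_λ, T/I_mT)` — the case `g = r • id` of lit's
`FsNaturalAt` (ii) (`FsNaturalAt.fsScalarNaturalAt`); the only naturality the transport needs.
[cite: Howard2004HeegnerKolyvagin, Def. 1.1.1 («`R`-submodule») and Def. 1.1.8 (arXiv p. 5)] -/
def FsScalarNaturalAt (D : LevelData R ρ t N) (hρ : ρ.IsScalarLinear R)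
    (m : Finset (HeightOneSpectrum (𝓞 K))) (v : HeightOneSpectrum (𝓞 K)) : Prop :=
  ∀ (r : R), ∀ c ∈ unramifiedSubgroup (GaloisRep.toLocal v (D.ρq m)) 1,
    D.fs m v (localH1Map (D.ρq m) (D.ρq m) v (r • LinearMap.id : N m →ₗ[R] N m).toAddMonoidHom
        (smul_id_toLocal (D.isScalarLinear hρ m) v r) c) =
      D.sqSMul hρ m v r (D.fs m v c)

omit [Fact p.Prime] in
/-- lit's (ii) `FsNaturalAt m m λ` (naturality along all locally equivariant `R`-linear endomorphisms)
implies naturality along the scalars. [cite: Howard2004HeegnerKolyvagin, Prop. 1.1.7 / Def. 1.1.8 (arXiv p. 5, L115–131)] -/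
theorem FsNaturalAt.fsScalarNaturalAt {D : LevelData R ρ t N} (hρ : ρ.IsScalarLinear R)
    {m : Finset (HeightOneSpectrum (𝓞 K))} {v : HeightOneSpectrum (𝓞 K)} (h : D.FsNaturalAt m m v) :
    D.FsScalarNaturalAt hρ m v :=
  fun r c hc => h.smul r (smul_toLocal_comm (D.isScalarLinear hρ m) v r) c hc

/-- The rescaled slot: «`fs₂ = u_ℓ · φ^{fs}_ℓ` on the finite classes of `T/I_{nℓ}T` at `ℓ`», for every
pair `(nℓ, ℓ)` at which display (ks relations) evaluates the slot.
[cite: Howard2004HeegnerKolyvagin, Def. 1.1.8 and Def. 1.2.3 (arXiv p. 5 L126–131, p. 6 L126–140)] -/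
def IsRescaledFs (D : LevelData R ρ t N) (hρ : ρ.IsScalarLinear R)
    (fs₂ : ∀ (n : Finset (HeightOneSpectrum (𝓞 K))) (v : HeightOneSpectrum (𝓞 K)),
      galoisCohomology ((D.ρq n).toLocal (Sum.inr v)) 1 →+
        SingularQuotient (GaloisRep.toLocal v (D.ρq n)) ⊗[ℤ] Gell v)
    (u : HeightOneSpectrum (𝓞 K) → R) : Prop :=
  ∀ (n : Finset (HeightOneSpectrum (𝓞 K))) (v : HeightOneSpectrum (𝓞 K)), v ∉ n →
    insert v n ∈ t.levelSet →
    ∀ c ∈ unramifiedSubgroup (GaloisRep.toLocal v (D.ρq (insert v n))) 1,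
      fs₂ (insert v n) v c = D.sqSMul hρ (insert v n) v (u v) (D.fs (insert v n) v c)

end LevelData

end Literature.NumberTheory.GaloisCohomology.Howard2004

end
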